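import Literature.Analysis.FluidPDE.PassiveScalar
import Literature.Analysis.FluidPDE.PassiveScalarForced
import Literature.Analysis.FunctionSpaces.TorusSpaceTime
import HarnessLib

/-!
# Classical well-posedness of the advection–diffusion equation with smooth drift on `T^d`

Topic `Literature/Analysis/FluidPDE` (trunk FluidKinetic). A named fact recording the classical
parabolic theory behind the sentence "let `θ^m` be the unique smooth solution of the advection
diffusion equation `∂ₜθ^m + v^m·∇θ^m = ν_m Δθ^m` on `[0,2]` with `θ^m(0) = ρ_in`" (Cheskidov,
arXiv:2311.04182, §4, (4.2), p. 12; likewise Bruè–De Lellis, CMP 400 (2023), §5–6): for a smooth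
drift `u` and a smooth source `s` on `[0,T] × T^d`, a diffusivity `κ > 0` and a smooth datum
`θ₀`, the forced advection–diffusion equation `∂ₜθ + u·∇θ = κΔθ + s` has exactly one classical
solution on `[0,T] × T^d` with `θ(0) = θ₀`, in the sense of the accepted
`Torus.IsClassicalScalarTransportForcedOn` (`PassiveScalarForced.lean`; joint `C^∞` up to the
time boundary, one-sided time derivatives). This is ingredient L2 of the decomposition of
`Literature.Analysis.FluidPDE.cheskidov_time_periodic_anomaly` (and of `Literature.Analysis.FluidPDE.brue_deLellis_anomalous_dissipation`),
see `QuasiSelfSimilarMixing.lean` for ingredient L1.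

## Source and reduction

Krylov, *Lectures on Elliptic and Parabolic Equations in Hölder Spaces* (AMS GSM 12, 1996),
Thm. 9.2.3: for a second-order operator `L = aⁱʲ∂ᵢⱼ + bⁱ∂ᵢ + c` on `ℝ^d` with coefficients in the
parabolic Hölder class `C^{δ/2,δ}`, uniformly elliptic, `c ≤ -λ < 0`, and data
`g ∈ C^{2+δ}(ℝ^d)`, `f ∈ C^{δ/2,δ}(Q)`, `Q = (0,T) × ℝ^d`, `T ∈ (0, ∞]`, there is a unique
`u ∈ C^{1+δ/2,2+δ}(Q)` with `uₜ = Lu + f` in `Q` and `u(0,·) = g`. Reduction of the torus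
statement to it (all standard, Krylov Ch. 8 introduction and §8.12): lift everything
`1`-periodically to `ℝ^d` (bounded smooth coefficients `aⁱʲ = κδⁱʲ`, `b = -u`, `c = 0`); the sign
condition on `c` is immaterial (`v = e^{-λt}θ` solves `vₜ = Lv - λv + e^{-λt}s`, Krylov p. 105,
remark after (8.0.2)); periodicity of the solution follows from uniqueness (translates by lattice
vectors solve the same problem); `C^∞` regularity in `x` and `t` up to `t = 0` follows by
differentiating the equation — the derivatives `D^α_x θ` solve Cauchy problems of the same type
with data `D^α g ∈ C^{2+δ}` (Thm. 9.2.3 again, uniqueness, Thm. 8.12.1), and time derivatives are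
read off from the equation (Ex. 8.12.4) — so the periodic solution descends to a jointly smooth
classical solution on `[0,T] × T^d`; uniqueness in the classical class on the torus is also the
elementary energy identity for the difference (`IsClassicalScalarTransportOn.hasDerivWithinAt_scalarL2Sq`).
Incompressibility of the drift plays no role in well-posedness; it is carried along only because
the accepted solution structure records it.

## References

* N. V. Krylov, *Lectures on Elliptic and Parabolic Equations in Hölder Spaces*, Graduate
  Studies in Mathematics 12, AMS (1996), Thm. 9.2.3 (p. 140 of the book; Cauchy problem),
  Thm. 8.12.1, Ex. 8.12.4 (better regularity), Ch. 8 introduction (reduction to `c ≤ -λ`).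
* A. Cheskidov, arXiv:2311.04182 (2023), §4, (4.2) (use on `[0,2] × T²`).
* E. Bruè, C. De Lellis, Comm. Math. Phys. 400 (2023), §6 (use on `[0,1] × T²`).
-/

noncomputable section

open MeasureTheory Set Filter Topology
open scoped InnerProductSpace

namespace Literature.Analysis.FluidPDE

namespace Torus

variable {d : Type*} [Fintype d] [DecidableEq d]

/-- **Classical well-posedness of forced advection–diffusion with smooth drift on the torus**
(standard parabolic theory: Krylov 1996, Thm. 9.2.3 with the regularity bootstrap of Thm. 8.12.1 /
Ex. 8.12.4, applied to the `1`-periodic lift — see the module docstring for the reduction; the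
statement in exactly this setting is the one used without proof in Cheskidov 2023, §4, (4.2) and
Bruè–De Lellis 2023, §6). For `κ > 0`, `T > 0`, a drift `u ∈ C^∞([0,T] × T^d; ℝ^d)` with
`div u(t) = 0`, a source `s ∈ C^∞([0,T] × T^d)` and a datum `θ₀ ∈ C^∞(T^d)` there exists a
classical solution `θ ∈ C^∞([0,T] × T^d)` of `∂ₜθ + u·∇θ = κΔθ + s` on `[0,T]` with `θ(0) = θ₀`
(`Torus.IsClassicalScalarTransportForcedOn (Icc 0 T) κ u s θ`), and any two such solutions agree
on `[0,T]`. (Values of `θ` outside `[0,T]` are unconstrained junk, whence uniqueness is stated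
slice-wise on `[0,T]`.) [cite: Krylov1996, Thm. 9.2.3] [cite: Cheskidov2023, §4 (4.2)] -/
def exists_unique_isClassicalScalarTransportForcedOn : Prop :=
  ∀ {κ T : ℝ} (_hκ : 0 < κ) (_hT : 0 < T) {u : ℝ → UnitAddTorus d → EuclideanSpace ℝ d}
    {s : ℝ → UnitAddTorus d → ℝ} {θ₀ : UnitAddTorus d → ℝ}
    (_hu : FunctionSpaces.Torus.IsSmoothSpaceTimeOn (Icc 0 T) u) (_hdiv : ∀ t ∈ Icc 0 T, FunctionSpaces.Torus.IsDivFree (u t))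
    (_hs : FunctionSpaces.Torus.IsSmoothSpaceTimeOn (Icc 0 T) s) (_hθ₀ : FunctionSpaces.Torus.IsSmooth θ₀),
    ∃ θ : ℝ → UnitAddTorus d → ℝ,
      IsClassicalScalarTransportForcedOn (Icc 0 T) κ u s θ ∧ θ 0 = θ₀ ∧
        ∀ θ' : ℝ → UnitAddTorus d → ℝ, IsClassicalScalarTransportForcedOn (Icc 0 T) κ u s θ' →
          θ' 0 = θ₀ → ∀ t ∈ Icc 0 T, θ' t = θ t

/-- The unforced case (`s = 0`), which is the form used by Cheskidov 2023, (4.2) and (6.3):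
existence and uniqueness of the classical solution of `∂ₜθ + u·∇θ = κΔθ`, `θ(0) = θ₀` on
`[0,T] × T^d` (`Torus.IsClassicalScalarTransportOn`), derived from the forced fact through
`isClassicalScalarTransportForcedOn_zero_iff`. [cite: Cheskidov2023, §4 (4.2)] -/
theorem exists_unique_isClassicalScalarTransportOn_of_forced
    (h : exists_unique_isClassicalScalarTransportForcedOn (d := d)) {κ T : ℝ} (hκ : 0 < κ)
    (hT : 0 < T) {u : ℝ → UnitAddTorus d → EuclideanSpace ℝ d} {θ₀ : UnitAddTorus d → ℝ}
    (hu : FunctionSpaces.Torus.IsSmoothSpaceTimeOn (Icc 0 T) u) (hdiv : ∀ t ∈ Icc 0 T, FunctionSpaces.Torus.IsDivFree (u t))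
    (hθ₀ : FunctionSpaces.Torus.IsSmooth θ₀) :
    ∃ θ : ℝ → UnitAddTorus d → ℝ,
      IsClassicalScalarTransportOn (Icc 0 T) κ u θ ∧ θ 0 = θ₀ ∧
        ∀ θ' : ℝ → UnitAddTorus d → ℝ, IsClassicalScalarTransportOn (Icc 0 T) κ u θ' →
          θ' 0 = θ₀ → ∀ t ∈ Icc 0 T, θ' t = θ t := by
  have h0 : FunctionSpaces.Torus.IsSmoothSpaceTimeOn (Icc 0 T) (0 : ℝ → UnitAddTorus d → ℝ) :=
    FunctionSpaces.Torus.isSmoothSpaceTimeOn_const (FunctionSpaces.Torus.isSmooth_const (0 : ℝ)) _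
  obtain ⟨θ, hθ, hθ0, huniq⟩ := h hκ hT hu hdiv h0 hθ₀
  refine ⟨θ, (isClassicalScalarTransportForcedOn_zero_iff h0).1 hθ, hθ0, fun θ' hθ' h0' => ?_⟩
  exact huniq θ' ((isClassicalScalarTransportForcedOn_zero_iff h0).2 hθ') h0'

end Torus

end Literature.Analysis.FluidPDE

end
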